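import Mathlib.Analysis.SpecialFunctions.Log.Basic
import Mathlib.Data.Set.Card
import Mathlib.Order.Interval.Set.Infinite

/-!
# Crux `AnalyticDetour` (stmt-QuantumFields-8801), line `registered`: path calculus

Route `GronwallGap`, sub-problem `YangMills`.  The crux and its open core (`stub_anchoredDetour`)
speak about *weight paths* `w : ℝ → (G → ℝ)` on `[0,1]` that are ADMISSIBLE (five pointwise
clauses on every `w s`, `s ∈ [0,1]`, plus a log-Lipschitz clause
`|log w s g − log w s' g| ≤ Λ |s − s'|`) and have Gateaux-analytic pressure at every parameter
(another pointwise clause `AnP (w s)`).  This file is the reusable, model-free calculus of such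
paths, stated for an ARBITRARY pointwise predicate `P : (G → ℝ) → Prop` (in the applications `P`
is the conjunction of the five admissibility clauses with `AnP`) and the log-Lipschitz clause:

* reversal `s ↦ w (1 − s)` and concatenation `s ↦ if s ≤ ½ then w₁ (2s) else w₂ (2s − 1)`
  preserve the pointwise clause and the log-Lipschitz clause (`pathReverse_*`, `pathConcat_*`);
* hence "`x` is joined to `y` by a `P`-path with log-Lipschitz parametrisation" is reflexive on
  `P`, symmetric and transitive (`reach_refl`, `reach_symm`, `reach_trans`);
* the real-line lemma `chain_of_localBypass`: if a relation `R` on couplings is transitive, holds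
  along every segment `[a, b] ⊂ (0, ∞)` free of an exceptional set `E` that is locally finite on
  `[0, ∞)`, and admits a LOCAL BYPASS around every coupling `c > 0` (non-exceptional points
  `m < c < p` close to `c` are `R`-related), then any two non-exceptional couplings
  `0 < a ≤ b` are `R`-related — finite induction on the number of exceptional points in `(a, b)`.

Pure logic and order theory; no named facts; no definitions (paths are explicit lambdas).
-/

noncomputable section

namespace Summit.QuantumFields.YangMills.Theorems

/-! ## Concatenation -/

/-- Pointwise-in-`s` properties transfer to the concatenated path
`s ↦ if s ≤ 1/2 then w₁ (2s) else w₂ (2s-1)`. -/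
theorem pathConcat_forall {G : Type} (Q : (G → ℝ) → Prop) {w₁ w₂ : ℝ → G → ℝ}
    (hQ₁ : ∀ s ∈ Set.Icc (0 : ℝ) 1, Q (w₁ s)) (hQ₂ : ∀ s ∈ Set.Icc (0 : ℝ) 1, Q (w₂ s)) :
    ∀ s ∈ Set.Icc (0 : ℝ) 1,
      Q ((fun s : ℝ => if s ≤ 1 / 2 then w₁ (2 * s) else w₂ (2 * s - 1)) s) := by
  intro s hs
  obtain ⟨hs0, hs1⟩ := hs
  by_cases h : s ≤ 1 / 2
  · simp only [if_pos h]
    exact hQ₁ (2 * s) ⟨by linarith, by linarith⟩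
  · simp only [if_neg h]
    rw [not_le] at h
    exact hQ₂ (2 * s - 1) ⟨by linarith, by linarith⟩

/-- Log-Lipschitz control of the concatenated path, ordered parameters (junction through
`w₁ 1 = w₂ 0`). -/
theorem pathConcat_log_lipschitz_of_le {G : Type} {w₁ w₂ : ℝ → G → ℝ} {Λ₁ Λ₂ : ℝ}
    (hL₁ : ∀ s ∈ Set.Icc (0 : ℝ) 1, ∀ s' ∈ Set.Icc (0 : ℝ) 1, ∀ g : G,
      |Real.log (w₁ s g) - Real.log (w₁ s' g)| ≤ Λ₁ * |s - s'|)
    (hL₂ : ∀ s ∈ Set.Icc (0 : ℝ) 1, ∀ s' ∈ Set.Icc (0 : ℝ) 1, ∀ g : G,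
      |Real.log (w₂ s g) - Real.log (w₂ s' g)| ≤ Λ₂ * |s - s'|)
    (hjoin : w₁ 1 = w₂ 0) {s s' : ℝ} (hss' : s ≤ s')
    (hs : s ∈ Set.Icc (0 : ℝ) 1) (hs' : s' ∈ Set.Icc (0 : ℝ) 1) (g : G) :
    |Real.log ((fun s : ℝ => if s ≤ 1 / 2 then w₁ (2 * s) else w₂ (2 * s - 1)) s g) -
        Real.log ((fun s : ℝ => if s ≤ 1 / 2 then w₁ (2 * s) else w₂ (2 * s - 1)) s' g)| ≤
      2 * (|Λ₁| + |Λ₂|) * (s' - s) := by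
  obtain ⟨hs0, hs1⟩ := hs
  obtain ⟨hs0', hs1'⟩ := hs'
  have hA₁ : 0 ≤ |Λ₁| := abs_nonneg _
  have hA₂ : 0 ≤ |Λ₂| := abs_nonneg _
  have hΛ₁ : Λ₁ ≤ |Λ₁| := le_abs_self _
  have hΛ₂ : Λ₂ ≤ |Λ₂| := le_abs_self _
  by_cases h' : s' ≤ 1 / 2
  · have h : s ≤ 1 / 2 := le_trans hss' h'
    simp only [if_pos h, if_pos h']
    have key := hL₁ (2 * s) ⟨by linarith, by linarith⟩ (2 * s') ⟨by linarith, by linarith⟩ g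
    have e : |2 * s - 2 * s'| = 2 * (s' - s) := by
      rw [abs_of_nonpos (by linarith)]; ring
    rw [e] at key
    have m : Λ₁ * (2 * (s' - s)) ≤ |Λ₁| * (2 * (s' - s)) :=
      mul_le_mul_of_nonneg_right hΛ₁ (by linarith)
    have n : 0 ≤ |Λ₂| * (s' - s) := mul_nonneg hA₂ (by linarith)
    linarith
  · rw [not_le] at h'
    by_cases h : s ≤ 1 / 2
    · simp only [if_pos h, if_neg (not_le.mpr h')]
      have k1 := hL₁ (2 * s) ⟨by linarith, by linarith⟩ 1 ⟨by norm_num, by norm_num⟩ g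
      have k2 := hL₂ 0 ⟨le_rfl, by norm_num⟩ (2 * s' - 1) ⟨by linarith, by linarith⟩ g
      have e1 : |2 * s - 1| = 1 - 2 * s := by
        rw [abs_of_nonpos (by linarith)]; ring
      have e2 : |(0 : ℝ) - (2 * s' - 1)| = 2 * s' - 1 := by
        rw [abs_of_nonpos (by linarith)]; ring
      rw [e1] at k1
      rw [e2] at k2
      have hj : w₁ 1 g = w₂ 0 g := by rw [hjoin]
      rw [hj] at k1
      have tri := abs_sub_le (Real.log (w₁ (2 * s) g)) (Real.log (w₂ 0 g))
        (Real.log (w₂ (2 * s' - 1) g))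
      have m1 : Λ₁ * (1 - 2 * s) ≤ |Λ₁| * (1 - 2 * s) :=
        mul_le_mul_of_nonneg_right hΛ₁ (by linarith)
      have m2 : Λ₂ * (2 * s' - 1) ≤ |Λ₂| * (2 * s' - 1) :=
        mul_le_mul_of_nonneg_right hΛ₂ (by linarith)
      have n1 : 0 ≤ |Λ₁| * (2 * s' - 1) := mul_nonneg hA₁ (by linarith)
      have n2 : 0 ≤ |Λ₂| * (1 - 2 * s) := mul_nonneg hA₂ (by linarith)
      linarith
    · rw [not_le] at h
      simp only [if_neg (not_le.mpr h), if_neg (not_le.mpr h')]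
      have key := hL₂ (2 * s - 1) ⟨by linarith, by linarith⟩ (2 * s' - 1)
        ⟨by linarith, by linarith⟩ g
      have e : |2 * s - 1 - (2 * s' - 1)| = 2 * (s' - s) := by
        rw [abs_of_nonpos (by linarith)]; ring
      rw [e] at key
      have m : Λ₂ * (2 * (s' - s)) ≤ |Λ₂| * (2 * (s' - s)) :=
        mul_le_mul_of_nonneg_right hΛ₂ (by linarith)
      have n : 0 ≤ |Λ₁| * (s' - s) := mul_nonneg hA₁ (by linarith)
      linarith

/-- Log-Lipschitz control of the concatenated path (constant `2 (|Λ₁| + |Λ₂|)`). -/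
theorem pathConcat_log_lipschitz {G : Type} {w₁ w₂ : ℝ → G → ℝ} {Λ₁ Λ₂ : ℝ}
    (hL₁ : ∀ s ∈ Set.Icc (0 : ℝ) 1, ∀ s' ∈ Set.Icc (0 : ℝ) 1, ∀ g : G,
      |Real.log (w₁ s g) - Real.log (w₁ s' g)| ≤ Λ₁ * |s - s'|)
    (hL₂ : ∀ s ∈ Set.Icc (0 : ℝ) 1, ∀ s' ∈ Set.Icc (0 : ℝ) 1, ∀ g : G,
      |Real.log (w₂ s g) - Real.log (w₂ s' g)| ≤ Λ₂ * |s - s'|)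
    (hjoin : w₁ 1 = w₂ 0) :
    ∀ s ∈ Set.Icc (0 : ℝ) 1, ∀ s' ∈ Set.Icc (0 : ℝ) 1, ∀ g : G,
      |Real.log ((fun s : ℝ => if s ≤ 1 / 2 then w₁ (2 * s) else w₂ (2 * s - 1)) s g) -
          Real.log ((fun s : ℝ => if s ≤ 1 / 2 then w₁ (2 * s) else w₂ (2 * s - 1)) s' g)| ≤
        2 * (|Λ₁| + |Λ₂|) * |s - s'| := by
  intro s hs s' hs' g
  rcases le_total s s' with hle | hle
  · rw [abs_of_nonpos (sub_nonpos.mpr hle), neg_sub]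
    exact pathConcat_log_lipschitz_of_le hL₁ hL₂ hjoin hle hs hs' g
  · rw [abs_of_nonneg (sub_nonneg.mpr hle), abs_sub_comm]
    exact pathConcat_log_lipschitz_of_le hL₁ hL₂ hjoin hle hs' hs g

/-! ## Reversal -/

/-- Pointwise-in-`s` properties transfer to the reversed path `s ↦ w (1 - s)`. -/
theorem pathReverse_forall {G : Type} (Q : (G → ℝ) → Prop) {w : ℝ → G → ℝ}
    (hQ : ∀ s ∈ Set.Icc (0 : ℝ) 1, Q (w s)) :
    ∀ s ∈ Set.Icc (0 : ℝ) 1, Q ((fun s : ℝ => w (1 - s)) s) := by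
  intro s hs
  obtain ⟨hs0, hs1⟩ := hs
  exact hQ (1 - s) ⟨by linarith, by linarith⟩

/-- The log-Lipschitz clause transfers to the reversed path with the same constant. -/
theorem pathReverse_log_lipschitz {G : Type} {w : ℝ → G → ℝ} {Λ : ℝ}
    (hL : ∀ s ∈ Set.Icc (0 : ℝ) 1, ∀ s' ∈ Set.Icc (0 : ℝ) 1, ∀ g : G,
      |Real.log (w s g) - Real.log (w s' g)| ≤ Λ * |s - s'|) :
    ∀ s ∈ Set.Icc (0 : ℝ) 1, ∀ s' ∈ Set.Icc (0 : ℝ) 1, ∀ g : G,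
      |Real.log ((fun s : ℝ => w (1 - s)) s g) - Real.log ((fun s : ℝ => w (1 - s)) s' g)| ≤
        Λ * |s - s'| := by
  intro s hs s' hs' g
  obtain ⟨hs0, hs1⟩ := hs
  obtain ⟨hs0', hs1'⟩ := hs'
  have key := hL (1 - s) ⟨by linarith, by linarith⟩ (1 - s') ⟨by linarith, by linarith⟩ g
  have e : |(1 - s) - (1 - s')| = |s - s'| := by
    rw [show (1 - s) - (1 - s') = -(s - s') by ring, abs_neg]
  rw [e] at key
  exact key

/-! ## Reachability by `P`-paths with log-Lipschitz parametrisation -/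

/-- The constant path: every `x` with `P x` is joined to itself (Lipschitz constant `0`). -/
theorem reach_refl {G : Type} (P : (G → ℝ) → Prop) {x : G → ℝ} (hx : P x) :
    ∃ w : ℝ → G → ℝ, (∀ s ∈ Set.Icc (0 : ℝ) 1, P (w s)) ∧
      (∃ Λ : ℝ, ∀ s ∈ Set.Icc (0 : ℝ) 1, ∀ s' ∈ Set.Icc (0 : ℝ) 1, ∀ g : G,
        |Real.log (w s g) - Real.log (w s' g)| ≤ Λ * |s - s'|) ∧ w 0 = x ∧ w 1 = x :=
  ⟨fun _ => x, fun _ _ => hx, ⟨0, fun s _ s' _ g => by simp⟩, rfl, rfl⟩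

/-- Reversal: if `x` is joined to `y` then `y` is joined to `x`. -/
theorem reach_symm {G : Type} (P : (G → ℝ) → Prop) {x y : G → ℝ}
    (h : ∃ w : ℝ → G → ℝ, (∀ s ∈ Set.Icc (0 : ℝ) 1, P (w s)) ∧
      (∃ Λ : ℝ, ∀ s ∈ Set.Icc (0 : ℝ) 1, ∀ s' ∈ Set.Icc (0 : ℝ) 1, ∀ g : G,
        |Real.log (w s g) - Real.log (w s' g)| ≤ Λ * |s - s'|) ∧ w 0 = x ∧ w 1 = y) :
    ∃ w : ℝ → G → ℝ, (∀ s ∈ Set.Icc (0 : ℝ) 1, P (w s)) ∧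
      (∃ Λ : ℝ, ∀ s ∈ Set.Icc (0 : ℝ) 1, ∀ s' ∈ Set.Icc (0 : ℝ) 1, ∀ g : G,
        |Real.log (w s g) - Real.log (w s' g)| ≤ Λ * |s - s'|) ∧ w 0 = y ∧ w 1 = x := by
  obtain ⟨w, hP, ⟨Λ, hL⟩, h0, h1⟩ := h
  refine ⟨fun s => w (1 - s), pathReverse_forall P hP, ⟨Λ, pathReverse_log_lipschitz hL⟩, ?_, ?_⟩
  · show w (1 - 0) = y
    rw [sub_zero]; exact h1
  · show w (1 - 1) = x
    rw [sub_self]; exact h0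

/-- Concatenation: if `x` is joined to `y` and `y` to `z` then `x` is joined to `z`. -/
theorem reach_trans {G : Type} (P : (G → ℝ) → Prop) {x y z : G → ℝ}
    (hxy : ∃ w : ℝ → G → ℝ, (∀ s ∈ Set.Icc (0 : ℝ) 1, P (w s)) ∧
      (∃ Λ : ℝ, ∀ s ∈ Set.Icc (0 : ℝ) 1, ∀ s' ∈ Set.Icc (0 : ℝ) 1, ∀ g : G,
        |Real.log (w s g) - Real.log (w s' g)| ≤ Λ * |s - s'|) ∧ w 0 = x ∧ w 1 = y)
    (hyz : ∃ w : ℝ → G → ℝ, (∀ s ∈ Set.Icc (0 : ℝ) 1, P (w s)) ∧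
      (∃ Λ : ℝ, ∀ s ∈ Set.Icc (0 : ℝ) 1, ∀ s' ∈ Set.Icc (0 : ℝ) 1, ∀ g : G,
        |Real.log (w s g) - Real.log (w s' g)| ≤ Λ * |s - s'|) ∧ w 0 = y ∧ w 1 = z) :
    ∃ w : ℝ → G → ℝ, (∀ s ∈ Set.Icc (0 : ℝ) 1, P (w s)) ∧
      (∃ Λ : ℝ, ∀ s ∈ Set.Icc (0 : ℝ) 1, ∀ s' ∈ Set.Icc (0 : ℝ) 1, ∀ g : G,
        |Real.log (w s g) - Real.log (w s' g)| ≤ Λ * |s - s'|) ∧ w 0 = x ∧ w 1 = z := by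
  obtain ⟨w₁, hP₁, ⟨Λ₁, hL₁⟩, h₁0, h₁1⟩ := hxy
  obtain ⟨w₂, hP₂, ⟨Λ₂, hL₂⟩, h₂0, h₂1⟩ := hyz
  have hjoin : w₁ 1 = w₂ 0 := h₁1.trans h₂0.symm
  refine ⟨fun s => if s ≤ 1 / 2 then w₁ (2 * s) else w₂ (2 * s - 1), pathConcat_forall P hP₁ hP₂,
    ⟨2 * (|Λ₁| + |Λ₂|), pathConcat_log_lipschitz hL₁ hL₂ hjoin⟩, ?_, ?_⟩
  · have h0 : ((0 : ℝ) ≤ 1 / 2) := by norm_num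
    simp only [if_pos h0, mul_zero]
    exact h₁0
  · have h1 : ¬ ((1 : ℝ) ≤ 1 / 2) := by norm_num
    simp only [if_neg h1]
    norm_num
    exact h₂1

/-! ## The real-line lemma: local bypasses chain across a locally finite exceptional set -/

/-- **Chaining local bypasses across a locally finite exceptional set.**  Let `E ⊂ ℝ` be locally
finite on `[0, ∞)` (`E ∩ [0, b]` finite for every `b`) and `R` a transitive relation on couplings
such that (i) `R a b` whenever `0 < a ≤ b` and the closed segment `[a, b]` contains no point of
`E`, and (ii) every coupling `c > 0` has a LOCAL BYPASS: some `δ > 0` such that `R m p` for all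
non-exceptional `m ∈ (c − δ, c)`, `p ∈ (c, c + δ)` with `m > 0`.  Then `R a b` for all
non-exceptional `0 < a ≤ b`.  Proof: induction on the number of exceptional points in `(a, b)`;
the least one, `c`, is bypassed from a point `m ∈ (a, c)` (reached from `a` along an `E`-free
segment) to a non-exceptional `p ∈ (c, min (c + δ) b)` (which exists because the interval is
infinite and `E ∩ [0, b]` is finite), and `(p, b)` contains strictly fewer exceptional points. -/
theorem chain_of_localBypass {E : Set ℝ} (hE : ∀ b : ℝ, (E ∩ Set.Icc 0 b).Finite)
    (R : ℝ → ℝ → Prop) (htrans : ∀ a b c : ℝ, R a b → R b c → R a c)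
    (hseg : ∀ a b : ℝ, 0 < a → a ≤ b → (∀ t ∈ Set.Icc a b, t ∉ E) → R a b)
    (hloc : ∀ c : ℝ, 0 < c → ∃ δ : ℝ, 0 < δ ∧ ∀ m ∈ Set.Ioo (c - δ) c, ∀ p ∈ Set.Ioo c (c + δ),
      0 < m → m ∉ E → p ∉ E → R m p) :
    ∀ a b : ℝ, 0 < a → a ≤ b → a ∉ E → b ∉ E → R a b := by
  -- finiteness of the exceptional points of a bounded open interval of positive couplings
  have hfin : ∀ a b : ℝ, 0 < a → (E ∩ Set.Ioo a b).Finite := fun a b ha =>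
    (hE b).subset fun t ht => ⟨ht.1, (ha.trans ht.2.1).le, ht.2.2.le⟩
  -- no exceptional point strictly inside and none at the ends: the segment
  have hfree : ∀ a b : ℝ, 0 < a → a ≤ b → a ∉ E → b ∉ E → E ∩ Set.Ioo a b = ∅ → R a b := by
    intro a b ha hab haE hbE hempty
    refine hseg a b ha hab fun t ht htE => ?_
    obtain ⟨hat, htb⟩ := ht
    rcases eq_or_lt_of_le hat with h | h
    · exact haE (h ▸ htE)
    rcases eq_or_lt_of_le htb with h' | h'
    · exact hbE (h' ▸ htE)
    have hmem : t ∈ E ∩ Set.Ioo a b := ⟨htE, h, h'⟩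
    rw [hempty] at hmem
    exact hmem
  -- induction on the number of exceptional points in `(a, b)`
  suffices H : ∀ (n : ℕ) (a b : ℝ), 0 < a → a ≤ b → a ∉ E → b ∉ E →
      (E ∩ Set.Ioo a b).ncard ≤ n → R a b by
    intro a b ha hab haE hbE
    exact H _ a b ha hab haE hbE le_rfl
  intro n
  induction n with
  | zero =>
    intro a b ha hab haE hbE hn
    refine hfree a b ha hab haE hbE ?_
    rw [← Set.ncard_eq_zero (hfin a b ha)]
    omega
  | succ n ih =>
    intro a b ha hab haE hbE hn
    by_cases hne : (E ∩ Set.Ioo a b).Nonempty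
    · -- `c` := the least exceptional point of `(a, b)`
      obtain ⟨c, hc, hcmin⟩ := Set.exists_min_image (E ∩ Set.Ioo a b) id (hfin a b ha) hne
      obtain ⟨hcE, hac, hcb⟩ := hc
      have hc0 : 0 < c := ha.trans hac
      obtain ⟨δ, hδ, hbyp⟩ := hloc c hc0
      -- `m ∈ (a, c) ∩ (c - δ, c)`
      set m : ℝ := max ((a + c) / 2) (c - δ / 2) with hm
      have ham : a < m := lt_of_lt_of_le (by linarith) (le_max_left _ _)
      have hmc : m < c := max_lt (by linarith) (by linarith)
      have hmδ : c - δ < m := lt_of_lt_of_le (by linarith) (le_max_right _ _)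
      have hm0 : 0 < m := ha.trans ham
      -- the segment `[a, m]` is free of exceptional points (minimality of `c`)
      have hsegfree : ∀ t ∈ Set.Icc a m, t ∉ E := by
        intro t ht htE
        obtain ⟨hat, htm⟩ := ht
        rcases eq_or_lt_of_le hat with h | h
        · exact haE (h ▸ htE)
        have htb : t < b := lt_trans (lt_of_le_of_lt htm hmc) hcb
        have hct : c ≤ t := hcmin t ⟨htE, h, htb⟩
        linarith
      have hmE : m ∉ E := hsegfree m ⟨ham.le, le_rfl⟩
      have Ram : R a m := hseg a m ha ham.le hsegfree
      -- a non-exceptional `p ∈ (c, min (c + δ) b)`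
      have hInf : (Set.Ioo c (min (c + δ) b) \ (E ∩ Set.Icc 0 b)).Infinite :=
        (Set.Ioo_infinite (lt_min (by linarith) hcb)).sdiff (hE b)
      obtain ⟨p, ⟨hcp, hpmin⟩, hpE'⟩ := hInf.nonempty
      have hpδ : p < c + δ := lt_of_lt_of_le hpmin (min_le_left _ _)
      have hpb : p < b := lt_of_lt_of_le hpmin (min_le_right _ _)
      have hp0 : 0 < p := hc0.trans hcp
      have hpE : p ∉ E := fun h => hpE' ⟨h, hp0.le, hpb.le⟩
      have Rmp : R m p := hbyp m ⟨hmδ, hmc⟩ p ⟨hcp, hpδ⟩ hm0 hmE hpE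
      -- `(p, b)` has strictly fewer exceptional points: induction hypothesis
      have hsub : E ∩ Set.Ioo p b ⊂ E ∩ Set.Ioo a b := by
        refine ⟨fun t ht => ⟨ht.1, lt_trans (hac.trans hcp) ht.2.1, ht.2.2⟩, fun hle => ?_⟩
        have hc' : c ∈ E ∩ Set.Ioo p b := hle ⟨hcE, hac, hcb⟩
        exact absurd hc'.2.1 (not_lt.mpr hcp.le)
      have hcard : (E ∩ Set.Ioo p b).ncard ≤ n := by
        have hlt := Set.ncard_lt_ncard hsub (hfin a b ha)
        omega
      exact htrans a p b (htrans a m p Ram Rmp) (ih p b hp0 hpb.le hpE hbE hcard)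
    · rw [Set.not_nonempty_iff_eq_empty] at hne
      exact hfree a b ha hab haE hbE hne

end Summit.QuantumFields.YangMills.Theorems

end
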